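import Summits.ValiantsHypothesis.ValiantsHypothesis.Theorems.LacunarySymmetroidMatrixDescartesFiniteSectorPairSumMasksShift
import Summits.ValiantsHypothesis.ValiantsHypothesis.Theorems.LacunarySymmetroidMatrixDescartesFiniteSectorSectorCeilingThreeFour

/-!
# `MatrixDescartes` — line «finite»: m-FOLD SUM BITMASKS (`m = 3, 4, 5`) — bridge theorems for the kernel checks of the `m ≥ 3` finite registers

HONEST FRAMING.  Object-search cell `pub-symmetroid`, seat val-sym-door-p5 g8.  HELPER material for the crux item `stmt-ValiantsHypothesis-18050` with NO
closure claim and no mathematical content of its own; companion of `…FiniteSectorPairSumMasks(Shift)`.  For `m ≥ 3` the sieve / T3 of line «finite» speak of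
`m`-fold sums of exponents; the `m`-fold sum SET of a value list `l` is carried as ONE natural number written WITHOUT a definition by iterating the shift form:
`HF₁ l = l.foldr (fun y acc => acc ||| 2^y) 0`, `HF₍ⱼ₊₁₎ l = l.foldr (fun x acc => acc ||| HFⱼ l * 2^x) 0` (spelled out `m` times in each statement).  This file
proves membership ⇒ bit for `m = 3, 4, 5`, the prefix-pruning lemmas for quadruple / quintuple sums (the pair / triple ones are `memP_prefix`, `memP3_prefix`),
and the unpacking of `Multiset` sums of card `4`, `5`.  Nothing here bears on the crux, the doors, or `VP ≠ VNP`.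
[folklore] Elementary bit bookkeeping (`Nat.testBit`); no citation is load-bearing.
-/

-- `Summit.ValiantsHypothesis.ValiantsHypothesis.…` repeats a component by the D-0017 layout
-- (single-conjunct summit), which the `dupNamespace` linter flags; the name is mandated.
set_option linter.dupNamespace false

namespace Summit.ValiantsHypothesis.ValiantsHypothesis.Theorems.LacunarySymmetroidMatrixDescartes.FiniteSector

/-! ## Membership ⇒ bit for triple, quadruple, quintuple sums -/

/-- **Triple sum ⇒ bit** of the 3-fold shift mask. [folklore] -/
theorem testBit_fold3Shift_of_mem {l : List ℕ} {r : ℕ} (h : ∃ x ∈ l, ∃ y ∈ l, ∃ z ∈ l, x + y + z = r) :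
    (List.foldr (fun x acc => acc ||| (List.foldr (fun x acc => acc ||| (List.foldr (fun y acc => acc ||| 2 ^ y) 0 l) * 2 ^ x) 0 l) * 2 ^ x) 0 l).testBit r = true := by
  rw [testBit_shiftFold]
  obtain ⟨x, hx, y, hy, z, hz, hs⟩ := h
  refine Or.inr ⟨x, hx, by omega, ?_⟩
  have : r - x = y + z := by omega
  rw [this]
  exact testBit_pairFoldShift_of_mem ⟨y, hy, z, hz, rfl⟩

/-- **Quadruple sum ⇒ bit** of the 4-fold shift mask. [folklore] -/
theorem testBit_fold4Shift_of_mem {l : List ℕ} {r : ℕ} (h : ∃ x ∈ l, ∃ y ∈ l, ∃ z ∈ l, ∃ w ∈ l, x + y + z + w = r) :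
    (List.foldr (fun x acc => acc ||| (List.foldr (fun x acc => acc ||| (List.foldr (fun x acc => acc ||| (List.foldr (fun y acc => acc ||| 2 ^ y) 0 l) * 2 ^ x) 0 l) * 2 ^ x) 0 l) * 2 ^ x) 0 l).testBit r = true := by
  rw [testBit_shiftFold]
  obtain ⟨x, hx, y, hy, z, hz, w, hw, hs⟩ := h
  refine Or.inr ⟨x, hx, by omega, ?_⟩
  have : r - x = y + z + w := by omega
  rw [this]
  exact testBit_fold3Shift_of_mem ⟨y, hy, z, hz, w, hw, rfl⟩

/-- **Quintuple sum ⇒ bit** of the 5-fold shift mask. [folklore] -/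
theorem testBit_fold5Shift_of_mem {l : List ℕ} {r : ℕ} (h : ∃ x ∈ l, ∃ y ∈ l, ∃ z ∈ l, ∃ w ∈ l, ∃ v ∈ l, x + y + z + w + v = r) :
    (List.foldr (fun x acc => acc ||| (List.foldr (fun x acc => acc ||| (List.foldr (fun x acc => acc ||| (List.foldr (fun x acc => acc ||| (List.foldr (fun y acc => acc ||| 2 ^ y) 0 l) * 2 ^ x) 0 l) * 2 ^ x) 0 l) * 2 ^ x) 0 l) * 2 ^ x) 0 l).testBit r = true := by
  rw [testBit_shiftFold]
  obtain ⟨x, hx, y, hy, z, hz, w, hw, v, hv, hs⟩ := h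
  refine Or.inr ⟨x, hx, by omega, ?_⟩
  have : r - x = y + z + w + v := by omega
  rw [this]
  exact testBit_fold4Shift_of_mem ⟨y, hy, z, hz, w, hw, v, hv, rfl⟩

/-! ## Prefix pruning for quadruple / quintuple sums -/

/-- If every element of `l₂` is `≥ x`, a quadruple sum `r < x` of `l₁ ++ l₂` is already one of `l₁`. [folklore] -/
theorem memP4_prefix {l₁ l₂ : List ℕ} {x r : ℕ} (hx : ∀ y ∈ l₂, x ≤ y) (hr : r < x) :
    (∃ p ∈ l₁ ++ l₂, ∃ q ∈ l₁ ++ l₂, ∃ s ∈ l₁ ++ l₂, ∃ t ∈ l₁ ++ l₂, p + q + s + t = r) →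
      (∃ p ∈ l₁, ∃ q ∈ l₁, ∃ s ∈ l₁, ∃ t ∈ l₁, p + q + s + t = r) := by
  rintro ⟨p, hp, q, hq, s, hs, t, ht, hsum⟩
  rw [List.mem_append] at hp hq hs ht
  rcases hp with hp | hp
  · rcases hq with hq | hq
    · rcases hs with hs | hs
      · rcases ht with ht | ht
        · exact ⟨p, hp, q, hq, s, hs, t, ht, hsum⟩
        · have := hx t ht; omega
      · have := hx s hs; omega
    · have := hx q hq; omega
  · have := hx p hp; omega

/-- If every element of `l₂` is `≥ x`, a quintuple sum `r < x` of `l₁ ++ l₂` is already one of `l₁`. [folklore] -/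
theorem memP5_prefix {l₁ l₂ : List ℕ} {x r : ℕ} (hx : ∀ y ∈ l₂, x ≤ y) (hr : r < x) :
    (∃ p ∈ l₁ ++ l₂, ∃ q ∈ l₁ ++ l₂, ∃ s ∈ l₁ ++ l₂, ∃ t ∈ l₁ ++ l₂, ∃ u ∈ l₁ ++ l₂, p + q + s + t + u = r) →
      (∃ p ∈ l₁, ∃ q ∈ l₁, ∃ s ∈ l₁, ∃ t ∈ l₁, ∃ u ∈ l₁, p + q + s + t + u = r) := by
  rintro ⟨p, hp, q, hq, s, hs, t, ht, u, hu, hsum⟩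
  rw [List.mem_append] at hp hq hs ht hu
  rcases hp with hp | hp
  · rcases hq with hq | hq
    · rcases hs with hs | hs
      · rcases ht with ht | ht
        · rcases hu with hu | hu
          · exact ⟨p, hp, q, hq, s, hs, t, ht, u, hu, hsum⟩
          · have := hx u hu; omega
        · have := hx t ht; omega
      · have := hx s hs; omega
    · have := hx q hq; omega
  · have := hx p hp; omega

/-! ## Unpacking multiset sums of card 4 and 5 -/

/-- A multiset of card `4` of indices has value sum `d i + d j + d k + d l`. [folklore] -/
theorem exists_sum_eq_of_card_four {K : ℕ} (d : Fin K → ℕ) (s : Multiset (Fin K)) (hs : Multiset.card s = 4) :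
    ∃ i j k l : Fin K, (s.map d).sum = d i + d j + d k + d l := by
  obtain ⟨a, t, rfl⟩ : ∃ a t, s = a ::ₘ t := by
    rcases Multiset.empty_or_exists_mem s with h | ⟨a, ha⟩
    · rw [h] at hs; simp at hs
    · exact ⟨a, s.erase a, (Multiset.cons_erase ha).symm⟩
  rw [Multiset.card_cons] at hs
  obtain ⟨i, j, k, rfl⟩ := Multiset.card_eq_three.mp (by omega : Multiset.card t = 3)
  refine ⟨a, i, j, k, ?_⟩
  simp [add_assoc]

/-- A multiset of card `5` of indices has value sum `d i + d j + d k + d l + d n`. [folklore] -/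
theorem exists_sum_eq_of_card_five {K : ℕ} (d : Fin K → ℕ) (s : Multiset (Fin K)) (hs : Multiset.card s = 5) :
    ∃ i j k l n : Fin K, (s.map d).sum = d i + d j + d k + d l + d n := by
  obtain ⟨a, t, rfl⟩ : ∃ a t, s = a ::ₘ t := by
    rcases Multiset.empty_or_exists_mem s with h | ⟨a, ha⟩
    · rw [h] at hs; simp at hs
    · exact ⟨a, s.erase a, (Multiset.cons_erase ha).symm⟩
  rw [Multiset.card_cons] at hs
  obtain ⟨i, j, k, l, h4⟩ := exists_sum_eq_of_card_four d t (by omega)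
  refine ⟨a, i, j, k, l, ?_⟩
  rw [Multiset.map_cons, Multiset.sum_cons, h4]
  ring

end Summit.ValiantsHypothesis.ValiantsHypothesis.Theorems.LacunarySymmetroidMatrixDescartes.FiniteSector
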